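import Summits.KontsevichZagierPeriods.Zeta5Search.FlagRayDescentData
import Summits.KontsevichZagierPeriods.Zeta5Search.RecordRayPhatDenominators
import HarnessLib

/-!
# The `P̂`-side denominator law on the FLAG-60 class ray `a = (11,24,14,22,17,23,26,19)·n`:
`2·d_{20n}·d_{21n}·d_{35n}·P̂_n ∈ ℤ` for every `n ≥ 1`, and the census's W-XS1 laws there (cell `pub-zeta5`, seat ct-1 g46)

HONEST FRAMING: systematic search; no irrationality claim unless certified.  INTEGRALITY of the dictionary `ζ(3)`-numerator
`P̂(n·a) = ρ(UV′ − U′V)` (`XSave.PhatOf`) on the ray of the cell's FLAG-60 class `60;10,12,16,18,22,24,28` (dual data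
`b = (60; 25,24,22,21,19,18,16)`, `d = 35`, `m₁ = 26`); nothing here concerns the arithmetic nature of `ζ(5)`/`ζ(3)`; the `P`-side,
the class's MODEL γ and the coordinator-fixed class words are NOT touched; records in print UNMOVED; net named-fact debt 0.
Theorems only (0 `def`).

OUR work (Summit side): the instance of `DescentPhatDenominatorsBox.two_mul_PhatOf_isInt` at the flag ray with
`D = d_{20n}·d_{21n}·d_{35n}` — the twin of `RecordRayPhatDenominators`.  The companions of (22) there are Rhin–Viola's
`I(20n, 42n−κ, 23n, 22n, κ−n, κ−3n, κ−4n, 17n)`, `κ ∈ [26n, 37n]`, with integers (2.8) `(κ, 18n, κ−2n, 19n, 19n, 21n, 21n, 20n)`, so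
Theorem 2.1 gives `d_κ·d_{κ−2n}·d_{21n}`; the weight `w_κ = ±C(κ,17n)C(11n,κ−26n)C(24n,κ−18n)` carries `d_κ ∣ d_{20n}·C(κ,17n)`
(Kummer, `max(17n, κ−17n) ≤ 20n`), and `d_{κ−2n} ∣ d_{35n}`:

* **`two_mul_lcm_flag_PhatOf_isInt`** — `∃ z : ℤ, z = 2·d_{20n}·d_{21n}·d_{35n}·P̂(n·a)` for every `n ≥ 1` and every partner `j ∈ [1,7]`;
* **`XS1_noPrimeBeyondD_flag`**, **`XS1_windowExponentLeOne_flag`** — the census's W-XS1 laws (`XSave.XS1_noPrimeBeyondD`: no prime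
  beyond `max(m₁n, d n) = 35n`; `XSave.XS1_windowExponentLeOne`: an odd prime beyond `m₁n = 26n` divides den `P̂` at most once)
  SPECIALISED TO `a = (11,24,14,22,17,23,26,19)`, every `n ≥ 1`, every partner, literally.
How far `d_{20n}d_{21n}d_{35n}` sits above the true denominator of `P̂(n·a)` below `20n` is NOT claimed.
-/

noncomputable section

open Finset

namespace Summit.KontsevichZagierPeriods.Zeta5Search.FlagRayPhatDenominators

open Literature.NumberTheory.Irrationality
open Literature.NumberTheory.Irrationality.BrownZudilin2022 (w22 pOf qOf bOfA Converges)
open Literature.NumberTheory.Irrationality.RhinViola2001 (Params d)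
open Literature.NumberTheory.Irrationality.RhinViola2001.Theorem21 (Dom)
open Summit.KontsevichZagierPeriods.Zeta5Search.WedgeDictionary (dOf)
open Summit.KontsevichZagierPeriods.Zeta5Search.XSave (PhatOf InRegion m1Of)
open Summit.KontsevichZagierPeriods.Zeta5Search.DescentPhatDenominatorsBox (two_mul_PhatOf_isInt)
open Summit.KontsevichZagierPeriods.Zeta5Search.SymmetricPhatXSave (padicValNat_lcmUpto log_eq_zero_of_lt)
open Summit.KontsevichZagierPeriods.Zeta5Search.FlagRayDescentData
open Summit.KontsevichZagierPeriods.Zeta5Search.RecordRayDescentData (lcmUpto_dvd_lcmUpto_max_mul_choose)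
open Summit.KontsevichZagierPeriods.Zeta5Search.RecordRayPhatDenominators (neg_padicValNat_le_padicValRat)

/-! ### The divisibility supplied by the weights -/

/-- For `26n ≤ k ≤ 37n`: `d_k·d_{k−2n}·d_{21n} ∣ (d_{20n}·d_{21n}·d_{35n})·C(k,17n)` (Kummer at `m = 17n`, `max(17n,k−17n) ≤ 20n`;
`k − 2n ≤ 35n`). -/
theorem lcm_triple_dvd (n k : ℕ) (h1 : 26 * n ≤ k) (h2 : k ≤ 37 * n) :
    Nat.lcmUpto k * Nat.lcmUpto (k - 2 * n) * Nat.lcmUpto (21 * n) ∣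
      Nat.lcmUpto (20 * n) * Nat.lcmUpto (21 * n) * Nat.lcmUpto (35 * n) * k.choose (17 * n) := by
  have hK := lcmUpto_dvd_lcmUpto_max_mul_choose (show 17 * n ≤ k by omega)
  have hmax : max (17 * n) (k - 17 * n) ≤ 20 * n := max_le (by omega) (by omega)
  have h20 : Nat.lcmUpto k ∣ Nat.lcmUpto (20 * n) * k.choose (17 * n) :=
    hK.trans (mul_dvd_mul_right (Literature.NumberTheory.LFunctions.lcmUpto_dvd_lcmUpto_of_le hmax) _)
  have h35 : Nat.lcmUpto (k - 2 * n) ∣ Nat.lcmUpto (35 * n) :=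
    Literature.NumberTheory.LFunctions.lcmUpto_dvd_lcmUpto_of_le (by omega)
  calc Nat.lcmUpto k * Nat.lcmUpto (k - 2 * n) * Nat.lcmUpto (21 * n)
      ∣ (Nat.lcmUpto (20 * n) * k.choose (17 * n)) * Nat.lcmUpto (35 * n) * Nat.lcmUpto (21 * n) :=
        mul_dvd_mul (mul_dvd_mul h20 h35) dvd_rfl
    _ = Nat.lcmUpto (20 * n) * Nat.lcmUpto (21 * n) * Nat.lcmUpto (35 * n) * k.choose (17 * n) := by ring

/-! ### The theorem -/

/-- **`2·d_{20n}·d_{21n}·d_{35n}·P̂(n·a) ∈ ℤ` on the flag ray `a = (11,24,14,22,17,23,26,19)`, every `n ≥ 1`, every partner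
`j ∈ [1,7]`.** -/
theorem two_mul_lcm_flag_PhatOf_isInt (n : ℕ) (hn : 1 ≤ n) (j : ℕ) (hj : j ∈ Icc 1 7) :
    ∃ z : ℤ, (z : ℚ) = 2 * ((Nat.lcmUpto (20 * n) * Nat.lcmUpto (21 * n) * Nat.lcmUpto (35 * n) : ℕ) : ℚ) *
      PhatOf (n • (![11, 24, 14, 22, 17, 23, 26, 19] : Fin 8 → ℤ)) j := by
  obtain ⟨⟨_, hconv, hreg, hd, hpart⟩, h2b, hp, hres, hcl2⟩ := inBox_flag n hn j hj
  refine two_mul_PhatOf_isInt _ j hj hconv hreg hd hpart h2b hp hres hcl2 _ fun κ hκ _ => ?_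
  rw [pOf_flag, qOf_flag] at hκ ⊢
  simp only [Matrix.cons_val, mem_Icc] at hκ ⊢
  refine ⟨κ, κ - 2 * n, 21 * n, (companion_dom_flag n κ hκ.1 (by omega)).1, (companion_dom_flag n κ hκ.1 (by omega)).2, ?_⟩
  -- the divisibility `d_κ d_{κ−2n} d_{21n} ∣ D·w_κ`, with `κ = k` a natural number
  obtain ⟨k, rfl⟩ : ∃ k : ℕ, κ = k := ⟨κ.toNat, (Int.toNat_of_nonneg (by omega)).symm⟩
  have hk1 : 26 * n ≤ k := by exact_mod_cast hκ.1
  have hk2 : k ≤ 37 * n := by have := hκ.2; omega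
  have hw := w22_flag n k hk1 hk2
  rw [pOf_flag, qOf_flag] at hw
  rw [hw]
  have hd1 : d (k : ℤ) = Nat.lcmUpto k := by simp only [d, Int.toNat_natCast]
  have hd2 : d ((k : ℤ) - 2 * n) = Nat.lcmUpto (k - 2 * n) := by
    rw [show (k : ℤ) - 2 * n = ((k - 2 * n : ℕ) : ℤ) by omega]; simp only [d, Int.toNat_natCast]
  have hd3 : d (21 * (n : ℤ)) = Nat.lcmUpto (21 * n) := by
    rw [show (21 * (n : ℤ)) = ((21 * n : ℕ) : ℤ) by push_cast; ring]; simp only [d, Int.toNat_natCast]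
  rw [hd1, hd2, hd3]
  have hX : ((Nat.lcmUpto k * Nat.lcmUpto (k - 2 * n) * Nat.lcmUpto (21 * n) : ℕ) : ℤ) ∣
      ((Nat.lcmUpto (20 * n) * Nat.lcmUpto (21 * n) * Nat.lcmUpto (35 * n) * k.choose (17 * n) *
        ((11 * n).choose (k - 26 * n) * (24 * n).choose (k - 18 * n)) : ℕ) : ℤ) :=
    Int.natCast_dvd_natCast.2 ((lcm_triple_dvd n k hk1 hk2).mul_right _)
  have hEq : ((Nat.lcmUpto (20 * n) * Nat.lcmUpto (21 * n) * Nat.lcmUpto (35 * n) : ℕ) : ℤ) *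
      ((-1) ^ (61 * n + k) * ((k.choose (17 * n) : ℕ) : ℤ) * (((11 * n).choose (k - 26 * n) : ℕ) : ℤ) *
        (((24 * n).choose (k - 18 * n) : ℕ) : ℤ)) =
      (-1) ^ (61 * n + k) * ((Nat.lcmUpto (20 * n) * Nat.lcmUpto (21 * n) * Nat.lcmUpto (35 * n) * k.choose (17 * n) *
        ((11 * n).choose (k - 26 * n) * (24 * n).choose (k - 18 * n)) : ℕ) : ℤ) := by
    push_cast; ring
  rw [hEq]
  exact dvd_mul_of_dvd_right hX _

/-! ### Valuations and the census's W-XS1 laws on the flag ray -/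

/-- `v_p(P̂(n·a)) ≥ −(v_p(2) + ⌊log_p 20n⌋ + ⌊log_p 21n⌋ + ⌊log_p 35n⌋)` on the flag ray (every prime, `n ≥ 1`, `j ∈ [1,7]`). -/
theorem padicValRat_PhatOf_flag_ge {p : ℕ} [hp : Fact p.Prime] (n : ℕ) (hn : 1 ≤ n) (j : ℕ) (hj : j ∈ Icc 1 7) :
    -((padicValNat p 2 + Nat.log p (20 * n) + Nat.log p (21 * n) + Nat.log p (35 * n) : ℕ) : ℤ) ≤
      padicValRat p (PhatOf (n • (![11, 24, 14, 22, 17, 23, 26, 19] : Fin 8 → ℤ)) j) := by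
  have hD : 2 * (Nat.lcmUpto (20 * n) * Nat.lcmUpto (21 * n) * Nat.lcmUpto (35 * n)) ≠ 0 :=
    mul_ne_zero two_ne_zero (mul_ne_zero (mul_ne_zero (Nat.lcmUpto_ne_zero _) (Nat.lcmUpto_ne_zero _)) (Nat.lcmUpto_ne_zero _))
  have h := neg_padicValNat_le_padicValRat (p := p) hD (X := PhatOf (n • (![11, 24, 14, 22, 17, 23, 26, 19] : Fin 8 → ℤ)) j)
    (by obtain ⟨z, hz⟩ := two_mul_lcm_flag_PhatOf_isInt n hn j hj; exact ⟨z, by rw [hz]; push_cast; ring⟩)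
  rw [padicValNat.mul two_ne_zero (mul_ne_zero (mul_ne_zero (Nat.lcmUpto_ne_zero _) (Nat.lcmUpto_ne_zero _))
      (Nat.lcmUpto_ne_zero _)), padicValNat.mul (mul_ne_zero (Nat.lcmUpto_ne_zero _) (Nat.lcmUpto_ne_zero _))
      (Nat.lcmUpto_ne_zero _), padicValNat.mul (Nat.lcmUpto_ne_zero _) (Nat.lcmUpto_ne_zero _),
    padicValNat_lcmUpto hp.out, padicValNat_lcmUpto hp.out, padicValNat_lcmUpto hp.out] at h
  push_cast at h ⊢
  linarith

/-- **W-XS1, upper half, on the flag ray**: the body of `XSave.XS1_noPrimeBeyondD` at `a = (11,24,14,22,17,23,26,19)`: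
no prime beyond `d(b(n·a)) = 35n` divides den `P̂(n·a)` (every `n ≥ 1`, every partner). -/
theorem XS1_noPrimeBeyondD_flag :
    ∀ (j n p : ℕ), 1 ≤ n → InRegion (n • (![11, 24, 14, 22, 17, 23, 26, 19] : Fin 8 → ℤ)) j → p.Prime →
      m1Of (n • (![11, 24, 14, 22, 17, 23, 26, 19] : Fin 8 → ℤ)) < p →
      dOf (bOfA (n • (![11, 24, 14, 22, 17, 23, 26, 19] : Fin 8 → ℤ))) < p →
      0 ≤ padicValRat p (PhatOf (n • (![11, 24, 14, 22, 17, 23, 26, 19] : Fin 8 → ℤ)) j) := by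
  intro j n p hn hR hp _ hd
  haveI : Fact p.Prime := ⟨hp⟩
  rw [dOf_flag] at hd
  have hd' : 35 * n < p := by exact_mod_cast hd
  have h := padicValRat_PhatOf_flag_ge (p := p) n hn j hR.1
  rw [log_eq_zero_of_lt (by omega : 20 * n < p), log_eq_zero_of_lt (by omega : 21 * n < p), log_eq_zero_of_lt hd',
    padicValNat.eq_zero_of_not_dvd (show ¬ p ∣ 2 from fun h2 => by have := Nat.le_of_dvd (by norm_num) h2; omega)] at h
  simpa using h

/-- `⌊log_p 35n⌋ ≤ 1` for a prime `p > 26n ≥ 26` (`35n < p²`). -/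
theorem log_thirtyfive_le_one {p n : ℕ} (hp : p.Prime) (hn : 1 ≤ n) (h : 26 * n < p) : Nat.log p (35 * n) ≤ 1 := by
  have hlt : 35 * n < p ^ 2 := by nlinarith [hp.two_le]
  have := (Nat.log_lt_iff_lt_pow hp.one_lt (by omega : 35 * n ≠ 0)).2 hlt
  omega

/-- **W-XS1, window half, on the flag ray**: the body of `XSave.XS1_windowExponentLeOne` at `a = (11,24,14,22,17,23,26,19)`:
an odd prime beyond `m₁(n·a) = 26n` divides den `P̂(n·a)` at most once. -/
theorem XS1_windowExponentLeOne_flag :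
    ∀ (j n p : ℕ), 1 ≤ n → InRegion (n • (![11, 24, 14, 22, 17, 23, 26, 19] : Fin 8 → ℤ)) j → p.Prime → p ≠ 2 →
      m1Of (n • (![11, 24, 14, 22, 17, 23, 26, 19] : Fin 8 → ℤ)) < p →
      -1 ≤ padicValRat p (PhatOf (n • (![11, 24, 14, 22, 17, 23, 26, 19] : Fin 8 → ℤ)) j) := by
  intro j n p hn hR hp hp2 hm
  haveI : Fact p.Prime := ⟨hp⟩
  rw [m1Of_flag] at hm
  have hm' : 26 * n < p := by exact_mod_cast hm
  have h := padicValRat_PhatOf_flag_ge (p := p) n hn j hR.1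
  have hlog := log_thirtyfive_le_one hp hn hm'
  rw [log_eq_zero_of_lt (by omega : 20 * n < p), log_eq_zero_of_lt (by omega : 21 * n < p),
    padicValNat.eq_zero_of_not_dvd (show ¬ p ∣ 2 from fun h2 => hp2 ((Nat.prime_dvd_prime_iff_eq hp Nat.prime_two).1 h2))]
    at h
  push_cast at h
  omega

end Summit.KontsevichZagierPeriods.Zeta5Search.FlagRayPhatDenominators
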